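import Summits.BirchSwinnertonDyer.BirchSwinnertonDyer.Theses.KatoDescentTamePotSupersingular
import Summits.BirchSwinnertonDyer.Rank1Residual.X11b.KolyvaginBottomPoint
import Summits.BirchSwinnertonDyer.Rank1Residual.X11b.Three.KolyvaginLine
import Summits.BirchSwinnertonDyer.Rank1Residual.X11b.BDPRouteRankOneBookkeeping
import Literature.NumberTheory.EllipticCurves.HeegnerPointsOfConductorOneData
import Literature.NumberTheory.EllipticCurves.HeegnerPointsOfConductorOneRationalityProofs
import Literature.NumberTheory.EllipticCurves.HeegnerPointsOfConductorOneGaloisConjProofs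
import Literature.NumberTheory.EllipticCurves.HeegnerPointsKolyvaginPrimaryGeneratorProofs
import Literature.NumberTheory.EllipticCurves.BSDSelmerCMPConverseHeegnerFieldProofs
import Literature.NumberTheory.EllipticCurves.CuspFormLFunctionLevelConductorProofs
import HarnessLib
import Summits.BirchSwinnertonDyer.BirchSwinnertonDyer.Theses.KatoDescentPotSupersingular
import Summits.BirchSwinnertonDyer.BirchSwinnertonDyer.Theorems.KatoDescentTamePotSupersingularJetchevIrreducibleReadingOfStubs
import Summits.BirchSwinnertonDyer.BirchSwinnertonDyer.Theorems.KatoDescentPotSupersingularJetchevIrreducibleReadingOfStubs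
import Summits.BirchSwinnertonDyer.BirchSwinnertonDyer.Theorems.KatoDescentTamePotSupersingularJetchevIrreducibleReadingDivisibilityCoreVertexBridge
import Summits.BirchSwinnertonDyer.BirchSwinnertonDyer.Theorems.Rank1ResidualJetRingClassFields
import Summits.BirchSwinnertonDyer.BirchSwinnertonDyer.Theorems.KatoDescentTamePotSupersingularJetchevIrreducibleReadingThm52KernelInputsIrred

/-!
# ARCHIVED skeleton v3 of crux `JetchevIrreducibleReadingByName` (was `Lines/birth.lean` @ 9eaa6f035676, registered sha 256ec88ec5ba,
# 2026-08-27T08:2xZ–09:xxZ; superseded by v4 after k8t-c4 g9 showed `stub_cor32Irred` = h32I FALSE as displayed).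
# Namespace renamed `.BirthV3` so it never clashes with the live `Lines/birth.lean`; NOT registered; kept for the record
# (the v3 composition through p508713 still elaborates). Original header follows.
-/

/-!
# Crux `JetchevIrreducibleReadingByName` (item stmt-BirchSwinnertonDyer-20165, shared K8-t′ / K9) — skeleton v3
# (planner `bsd-potss-plan` g22, 2026-08-27; v2 = git history of this file @ cfebba652cc8 / sha 6ca99a22, v1 @ cb754136f12a)

WHY v3. `bsd-potss-k8t-c4` g8 CUT v2's hardest stub `stub_thm52RowObjectsAddv` ([J] Thm. 5.2 for the row objects at an
ADDITIVE `p`, `E[p]` IRREDUCIBLE) IN THE KERNEL: `JetchevIrreducibleReadingThm52.tamagawaExponent_le_mInfty_of_kernelInputs_of_irreducible`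
(p508713, over p507503 bricks / p507696 adapters / p508077 row form) = bsd-jet's H63 assembly with the `p`-adic tower
replaced by `hirr + p ∣ N`, needing per row ONLY the two Čebotarev-type READINGS `h32I` ([McC] Cor. 3.2, irreducible) and
`h44I` ([McC] Prop. 4.4, irreducible) plus bsd-jet's tower-case RESIDUAL (named print `hCM1`, `hCM2`, Gross Prop. 5.3
`h53`, [GZ86 III (3.1)] `hGZ`/`hcop′`; kernel gaps `htr`, `h49str`, `h49tr`, `hdual_q`, `hdual_ℓ` for SOME structures
`𝒯 𝒮 Qcar C′`). v3 makes exactly these the registered targets: v2's `Sig.stub_thm52RowObjectsAddv` becomes the PROVED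
node `Sig.H63IRowObjectsAddv` (`H63IRowObjectsAddv_of`, a real proof through p508713) over THREE new stubs, and the
stub set is (7 = stubs_max; each a genuine piece, none the crux reworded):

* `stub_structureIrred` (S1, v1-verbatim; MN19 Thm 0.7/§0.11 structure theorem, irreducible, no reduction binder —
  = Literature `MatarNekovar2019.thm07_…` p503175 in substance, published input, XL);
* `stub_prop52Irred` (v2-verbatim; McCallum Prop. 5.2 read under irreducibility — READING);
* `stub_coreVertexExistenceIrred` (v2-verbatim; Jetchev Prop. 5.3 = arXiv Prop. 6.4 read under irreducibility — READING);
* `stub_cor32Irred` (NEW = p508713's `h32I` verbatim: [McC] Cor. 3.2 — infinitely many Kolyvagin primes `ℓ` with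
  prescribed local orders of finitely many independent eigen-classes — with `onto` replaced by `E[p]` irreducible; the
  surjective original is PROVED in the tree (`McCallum1991.cor32_eigenclasses_infinite_primes_localOrder_holds`, bsd-jet),
  by a proof using `−1 ∈ ρ̄(G_K)`; Jetchev Rem. 6.2 asserts the irreducible reading);
* `stub_prop44Irred` (NEW = p508713's `h44I` verbatim: [McC] Prop. 4.4 — the local-condition comparison of the classes
  `P(mℓ)` vs `P(m)` at `λ ∣ ℓ` — irreducible reading);
* `stub_thm52KernelGapsAddv` (NEW, **hardest**: for the ROW OBJECTS of v2's H63I binders — additive `p`, `p ∤ c_p`,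
  global Tamagawa binder, `q ∥ N`, `q ≠ p`, core vertex `c` at level `k > max(t, m_∞)`, `t = ord_p c_q` — the named
  print `hCM1 ∧ hCM2 ∧ ∃ε h53 ∧ ∃n′ hGZ` holds AND there EXIST Selmer structures `𝒯` (transverse at the primes of `c`),
  `𝒮 ≤` Kummer, carrier places `Qcar` disjoint from `c`, `e′ = ε(−1)^r`, `C′ ≤` the `−e′` sign part, satisfying the
  five kernel gaps = Jetchev's Prop. 4.9 (stringent/transverse parts), Thm. 5.1 at the carrier with `#dual = p^t`, and
  Thm. 5.1/Lemma 5.2 (iii) at `λ` — i.e. bsd-jet register row D5's residual instantiated at an additive `p`);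
* `stub_publishedInputsHeegner` (cite; the route's held conjunction `PublishedInputsHeegner`, item 19914).

`JetchevIrreducibleReadingByName_of` (K8-t′ decl) / `_of_K9` (K9 decl, shared signature) are REAL proofs from the seven
stubs (g8's capstones p502280 / p502729, the S2 cut p504157 / p504855, and p508713). `lean check`: sorries ONLY in
`stub_*` (7). HONEST FRAMING: conditional throughout; nothing booked; the crux, its stubs and BSD are as open as before.
Alternative lines on this crux: `Lines/alt_depthIndex_plan_g21.lean` (planner's depth-index cut); v2 in git history.
Source of the cut: bsd-potss-k8t-c4 g8 FINDING v3 §§5–6 (`pub/bsd-potss/k8t-c4/FINDING-20165-irreducible-roadK-k8t-c4-g8.md`).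

References: [cite: Jetchev2008, Cor. 1.5, Thm. 1.4, Prop. 4.4, Prop. 4.9, Lemma 5.1, Thm. 5.1, Prop. 5.3, Thm. 5.2 (p. 821), Rem. 6.2]
[cite: MatarNekovar2019, Thm. 0.7, §0.11] [cite: McCallumLMS1991, §3 Cor. 3.2, §4 Prop. 4.4, Prop. 5.2, Cor. 5.6]
[cite: GrossLMS1991, §3, Prop. 5.3, Prop. 5.4, Prop. 6.2 (1)] [cite: GrossZagier1986, III (3.1)] [cite: Cox2013, §9.A]
-/


set_option linter.dupNamespace false
set_option autoImplicit false

noncomputable section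

open scoped Classical

open WeierstrassCurve IsDedekindDomain NumberField Literature.NumberTheory.EllipticCurves
open Literature.NumberTheory.EllipticCurves.Jetchev2008
open Literature.NumberTheory.GaloisRepresentations Literature.NumberTheory.GaloisRepresentations.DiscreteGaloisModule
open Summit.BirchSwinnertonDyer.Rank1Residual.JET
open Literature.NumberTheory.EllipticCurves.ModularForms
open Literature.NumberTheory.EllipticCurves.Rank1Residual
open Summit.BirchSwinnertonDyer.Rank1Residual Summit.BirchSwinnertonDyer.Rank1Residual.X11b
open Summit.BirchSwinnertonDyer.BirchSwinnertonDyer.Theses.KatoDescentTamePotSupersingular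
open Summit.BirchSwinnertonDyer.BirchSwinnertonDyer.Theorems
open Summit.BirchSwinnertonDyer.BirchSwinnertonDyer.Theorems.JetchevIrreducibleReadingDivisibility

namespace Summit.BirchSwinnertonDyer.BirchSwinnertonDyer.Cruxes.JetchevIrreducibleReadingByName.BirthV3

/-- Statement of `stub_structureIrred` (S1): Kolyvagin's structure theorem, UPPER half, under IRREDUCIBILITY of
`E[p]`, with NO reduction-type binder at `p` (McCallum currency): `ord_p #Ш(E/K)[p^∞] + 2t ≤ 2M₀`
(`p^{M₀} ∥ y_K` in `E(K)`) when every derived Heegner point is `p^s`-divisible at every depth `s ≤ t`.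
= `Cha2005.rmk25_padicValNat_card_sha_primary_add_le_of_globalDivisibility` minus `p ∤ d_K`, `p² ∤ N`
(Matar–Nekovář 2019 Thm. 0.7 + §0.11; McCallum 1991 Cor. 5.6). -/
abbrev Sig.stub_structureIrred : Prop :=
  ∀ (W : WeierstrassCurve ℚ) [W.IsElliptic] [W.IsGloballyMinimal] [NeZero (W.conductorNorm ℤ)],
    ¬ W.HasCM →
    ∀ (K : Type) [Field K] [NumberField K], IsImaginaryQuadratic K →
    NumberField.discr K ≠ -3 → NumberField.discr K ≠ -4 →
    SatisfiesHeegnerHypothesis (W.conductorNorm ℤ) K →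
    ∀ (p : ℕ) [Fact p.Prime], p ≠ 2 → W.HasIrreducibleModPGaloisRep p →
    ∀ (Dt : ModularParametrizationData W (W.conductorNorm ℤ)) (β : ℤ) (ι : K →+* ℂ)
      (d₁ : KolyvaginHeegnerData Dt β ι 1) (P : (W.baseChange K).toAffine.Point),
      d₁.toGeomPoints d₁.derivedPoint = toGeomPoints (W.baseChange K) P →
      ¬ IsOfFinAddOrder P →
    ∀ (M₀ : ℕ),
      (∃ Q : (W.baseChange K).toAffine.Point, ((p ^ M₀ : ℕ) : ℤ) • Q = P) →
      (¬ ∃ Q : (W.baseChange K).toAffine.Point, ((p ^ (M₀ + 1) : ℕ) : ℤ) • Q = P) →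
    ∀ (t : ℕ),
      (∀ (s : ℕ), s ≤ t → ∀ (n : ℕ) (d : KolyvaginHeegnerData Dt β ι n), Squarefree n →
        (∀ ℓ ∈ n.primeFactors, Zhang2014.IsKolyvaginPrime (W.conductorNorm ℤ) W K p ℓ ∧
          s ≤ Zhang2014.kolyvaginIndex W p ℓ) →
        ∃ Q : (W.baseChange (ringClassField K ι n)).toAffine.Point,
          ((p ^ s : ℕ) : ℤ) • Q = d.derivedPoint) →
    padicValNat p (Nat.card (AddCommGroup.primaryComponent (W.baseChange K).sha p)) + 2 * t ≤ 2 * M₀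

abbrev Sig.S2DivisibilityIrredAddv : Prop :=
  ∀ (W : WeierstrassCurve ℚ) [W.IsElliptic] [W.IsGloballyMinimal] [NeZero (W.conductorNorm ℤ)],
    ¬ W.HasCM →
    ∀ (K : Type) [Field K] [NumberField K], IsImaginaryQuadratic K →
    NumberField.discr K ≠ -3 → NumberField.discr K ≠ -4 →
    SatisfiesHeegnerHypothesis (W.conductorNorm ℤ) K →
    ∀ (p : ℕ) [Fact p.Prime], p ≠ 2 → Addv W p → 0 ≤ padicValRat p W.j →
    W.HasIrreducibleModPGaloisRep p →
    ¬ p ∣ (W.baseChange ℚ_[p]).localTamagawaNumber ℤ_[p] →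
    (∀ (q' : ℕ) [Fact q'.Prime], q' ∣ W.conductorNorm ℤ →
      p ∣ (W.baseChange ℚ_[q']).localTamagawaNumber ℤ_[q'] → ¬ q' ^ 2 ∣ W.conductorNorm ℤ) →
    ∀ (Dt : ModularParametrizationData W (W.conductorNorm ℤ)) (β : ℤ) (ι : K →+* ℂ)
      (d₁ : KolyvaginHeegnerData Dt β ι 1), ¬ IsOfFinAddOrder d₁.derivedPoint →
    ∀ (q : ℕ) [Fact q.Prime], q ∣ W.conductorNorm ℤ → ¬ q ^ 2 ∣ W.conductorNorm ℤ → q ≠ p →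
    ∀ (s : ℕ), s ≤ padicValNat p ((W.baseChange ℚ_[q]).localTamagawaNumber ℤ_[q]) →
    ∀ (n : ℕ) (d : KolyvaginHeegnerData Dt β ι n), Squarefree n →
      (∀ ℓ ∈ n.primeFactors, Zhang2014.IsKolyvaginPrime (W.conductorNorm ℤ) W K p ℓ ∧
        s ≤ Zhang2014.kolyvaginIndex W p ℓ) →
      ∃ Q : (W.baseChange (ringClassField K ι n)).toAffine.Point,
        ((p ^ s : ℕ) : ℤ) • Q = d.derivedPoint

/-- Statement of `stub_prop52Irred`: McCallum 1991 Prop. 5.2 («`M_r < M ⟹ ∃ c ∈ Λ^r_M` with `ord P(c)` of exact order `p^{M−M_r}`») in the IRREDUCIBLE reading — the `p`-adic-tower / surjectivity binder replaced by `W.HasIrreducibleModPGaloisRep p` (valid under absolute irreducibility by Jetchev 2008 Rem. 6.2: the proof uses the image only through the Čebotarev Cor. 3.2). VERBATIM the hypothesis `h52I` of `divisibilityIrredAddv_of_prop52Irred_of_coreVertexExistenceIrred_of_thm63` (p504855). A READING, displayed, nothing asserted. [cite: McCallumLMS1991, §5 Prop. 5.2 (p. 304), §3 Cor. 3.2] [cite: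 Jetchev2008, Rem. 6.2] -/
abbrev Sig.stub_prop52Irred : Prop :=
   ∀ (W : WeierstrassCurve ℚ) [W.IsElliptic] [W.IsGloballyMinimal] [NeZero (W.conductorNorm ℤ)],
      ¬ W.HasCM →
      ∀ (K : Type) [Field K] [NumberField K], IsImaginaryQuadratic K →
      NumberField.discr K ≠ -3 → NumberField.discr K ≠ -4 →
      SatisfiesHeegnerHypothesis (W.conductorNorm ℤ) K →
      ∀ (p : ℕ) [Fact p.Prime], p ≠ 2 → W.HasIrreducibleModPGaloisRep p →
      ∀ (Dt : ModularParametrizationData W (W.conductorNorm ℤ)) (β : ℤ) (ι : K →+* ℂ)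
        (d₁ : KolyvaginHeegnerData Dt β ι 1), ¬ IsOfFinAddOrder d₁.derivedPoint →
      ∀ (r : ℕ), 0 < r →
      ∀ (Mr : ℕ),
        IsLeast {u : ℕ | ∃ (n : ℕ) (d : KolyvaginHeegnerData Dt β ι n), Squarefree n ∧
            n.primeFactors.card = r ∧
            (∀ ℓ ∈ n.primeFactors, Zhang2014.IsKolyvaginPrime (W.conductorNorm ℤ) W K p ℓ ∧
              u + 1 ≤ Zhang2014.kolyvaginIndex W p ℓ) ∧
            (∃ Q : (W.baseChange (ringClassField K ι n)).toAffine.Point,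
              ((p ^ u : ℕ) : ℤ) • Q = d.derivedPoint) ∧
            ¬ ∃ Q : (W.baseChange (ringClassField K ι n)).toAffine.Point,
              ((p ^ (u + 1) : ℕ) : ℤ) • Q = d.derivedPoint} Mr →
      ∀ (M : ℕ), Mr < M →
        ∃ (n : ℕ) (d : KolyvaginHeegnerData Dt β ι n), Squarefree n ∧ n.primeFactors.card = r ∧
          (∀ ℓ ∈ n.primeFactors, Zhang2014.IsKolyvaginPrime (W.conductorNorm ℤ) W K p ℓ ∧
            M ≤ Zhang2014.kolyvaginIndex W p ℓ) ∧
          addOrderOf (d.kolyvaginClass (Fact.out : p.Prime) M) = p ^ (M - Mr) ∧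
          (∃ Q : (W.baseChange (ringClassField K ι n)).toAffine.Point,
            ((p ^ Mr : ℕ) : ℤ) • Q = d.derivedPoint) ∧
          ¬ ∃ Q : (W.baseChange (ringClassField K ι n)).toAffine.Point,
            ((p ^ (Mr + 1) : ℕ) : ℤ) • Q = d.derivedPoint

/-- Statement of `stub_coreVertexExistenceIrred`: Jetchev 2008 Prop. 5.3 (= arXiv:math/0703431 Prop. 6.4: a core vertex of every level `m ≥ 1` above a conductor with non-torsion, exactly-`p^s`-divisible derived point and `s + m ≤ M(c)`) in the IRREDUCIBLE reading — bsd-jet's reading binder `JET.JetchevCoreVertexExistence` with its tower binder replaced by `W.HasIrreducibleModPGaloisRep p`. VERBATIM the hypothesis `hCVI` of p504855. A READING, displayed, nothing asserted. [cite: Jetchev2008, Prop. 5.3 (p. 823), Lemma 5.1, Rem. 6.2] -/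
abbrev Sig.stub_coreVertexExistenceIrred : Prop :=
   ∀ (W : WeierstrassCurve ℚ) [W.IsElliptic] [W.IsGloballyMinimal] [NeZero (W.conductorNorm ℤ)],
      ¬ W.HasCM →
      ∀ (K : Type) [Field K] [NumberField K], IsImaginaryQuadratic K →
      NumberField.discr K ≠ -3 → NumberField.discr K ≠ -4 →
      SatisfiesHeegnerHypothesis (W.conductorNorm ℤ) K →
      ∀ (τ : K ≃ₐ[ℚ] K), τ ≠ 1 →
      ∀ (p : ℕ) [Fact p.Prime], p ≠ 2 → W.HasIrreducibleModPGaloisRep p →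
      ∀ (Dt : ModularParametrizationData W (W.conductorNorm ℤ)) (β : ℤ) (ι : K →+* ℂ)
        [∀ k : ℕ, NumberField (ringClassField K ι k)]
        (d₁ : KolyvaginHeegnerData Dt β ι 1), ¬ IsOfFinAddOrder d₁.derivedPoint →
      ∀ (m : ℕ), 1 ≤ m →
      ∀ (c : ℕ) (d : KolyvaginHeegnerData Dt β ι c), Squarefree c →
        (∀ ℓ ∈ c.primeFactors, Zhang2014.IsKolyvaginPrime (W.conductorNorm ℤ) W K p ℓ) →
      ∀ (s : ℕ), ¬ IsOfFinAddOrder d.derivedPoint →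
        (∃ Q : (W.baseChange (ringClassField K ι c)).toAffine.Point,
          ((p ^ s : ℕ) : ℤ) • Q = d.derivedPoint) →
        (¬ ∃ Q : (W.baseChange (ringClassField K ι c)).toAffine.Point,
          ((p ^ (s + 1) : ℕ) : ℤ) • Q = d.derivedPoint) →
        ((s + m : ℕ) : ℕ∞) ≤ Zhang2014.levelIndex W p c →
        ∃ (c' : ℕ) (d' : KolyvaginHeegnerData Dt β ι c'), Squarefree c' ∧
          (∀ ℓ ∈ c'.primeFactors, Zhang2014.IsKolyvaginPrime (W.conductorNorm ℤ) W K p ℓ ∧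
            m + s ≤ Zhang2014.kolyvaginIndex W p ℓ) ∧
          Jetchev2008.IsGlobalCoreVertex W K ι τ p m c' ∧
          ¬ IsOfFinAddOrder d'.derivedPoint ∧
          ¬ ∃ Q : (W.baseChange (ringClassField K ι c')).toAffine.Point,
            ((p ^ (s + 1) : ℕ) : ℤ) • Q = d'.derivedPoint

/-- v2's `Sig.stub_thm52RowObjectsAddv`, NO LONGER A STUB in v3 (proved from `stub_cor32Irred`, `stub_prop44Irred`,
`stub_thm52KernelGapsAddv` by `H63IRowObjectsAddv_of` through p508713): [J] Thm. 5.2 (= arXiv Thm. 6.3, the core-vertex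
kernel bound `ord_p c_q ≤ m_∞`) INSTANTIATED for the row objects under the additive-`p` binders. Body byte-identical to
v2's stub. [cite: Jetchev2008, Thm. 5.2 (p. 821)] -/
abbrev Sig.H63IRowObjectsAddv : Prop :=
   ∀ (W : WeierstrassCurve ℚ) [W.IsElliptic] [W.IsGloballyMinimal] [NeZero (W.conductorNorm ℤ)],
    ¬ W.HasCM → ∀ (K : Type) [Field K] [NumberField K], IsImaginaryQuadratic K →
    NumberField.discr K ≠ -3 → NumberField.discr K ≠ -4 →
    SatisfiesHeegnerHypothesis (W.conductorNorm ℤ) K →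
    ∀ (τ : K ≃ₐ[ℚ] K), τ ≠ 1 →
    ∀ (p : ℕ) [Fact p.Prime], p ≠ 2 → Rank1Residual.Addv W p → 0 ≤ padicValRat p W.j →
    W.HasIrreducibleModPGaloisRep p →
    ¬ p ∣ (W.baseChange ℚ_[p]).localTamagawaNumber ℤ_[p] →
    (∀ (q' : ℕ) [Fact q'.Prime], q' ∣ W.conductorNorm ℤ →
      p ∣ (W.baseChange ℚ_[q']).localTamagawaNumber ℤ_[q'] → ¬ q' ^ 2 ∣ W.conductorNorm ℤ) →
    ∀ (Dt : ModularParametrizationData W (W.conductorNorm ℤ)) (β : ℤ) (ι : K →+* ℂ)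
      [∀ k : ℕ, NumberField (ringClassField K ι k)]
      (d₁ : KolyvaginHeegnerData Dt β ι 1), ¬ IsOfFinAddOrder d₁.derivedPoint →
    ∀ (q : ℕ) [Fact q.Prime], q ∣ W.conductorNorm ℤ → ¬ q ^ 2 ∣ W.conductorNorm ℤ → q ≠ p →
    ∀ (mdiv m : {c : ℕ // Squarefree c ∧ ∀ ℓ ∈ c.primeFactors,
        Zhang2014.IsKolyvaginPrime (W.conductorNorm ℤ) W K p ℓ} → ℕ∞),
    (∀ c (u : ℕ), (u : ℕ∞) ≤ mdiv c ↔ ∀ d : KolyvaginHeegnerData Dt β ι c.1,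
      ∃ Q : (W.baseChange (ringClassField K ι c.1)).toAffine.Point,
        ((p ^ u : ℕ) : ℤ) • Q = d.derivedPoint) →
    (∀ c, m c = if mdiv c < Zhang2014.levelIndex W p c.1 then mdiv c else ⊤) →
    ∀ mInf : ℕ, (∀ c, (mInf : ℕ∞) ≤ m c) →
      (∀ m' : ℕ, ∃ c, (m' : ℕ∞) ≤ Zhang2014.levelIndex W p c.1 ∧ m c = mInf) →
    ∀ (k : ℕ) c, 1 ≤ k → Jetchev2008.IsGlobalCoreVertex W K ι τ p k c.1 → m c = mInf →
      (k : ℕ∞) + mInf ≤ Zhang2014.levelIndex W p c.1 →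
      padicValNat p ((W.baseChange ℚ_[q]).localTamagawaNumber ℤ_[q]) < k → mInf < k →
      padicValNat p ((W.baseChange ℚ_[q]).localTamagawaNumber ℤ_[q]) ≤ mInf

/-- Statement of `stub_cor32Irred` (NEW in v3; = the hypothesis `h32I` of p508713 VERBATIM): McCallum 1991 Cor. 3.2 —
infinitely many Kolyvagin primes `ℓ` (Frobenius of `ℓ` = complex conjugation in `K(E[p^M])/ℚ`, Kolyvagin index `≥ M`)
realising prescribed local orders `p^(N i)` of finitely many independent `±`-eigen-classes `cs i ∈ H¹(K, E[p^M])` —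
with McCallum's surjectivity hypothesis REPLACED by `E[p]` irreducible (the reading of Jetchev Rem. 6.2). The surjective
original is PROVED in the tree (`McCallum1991.cor32_eigenclasses_infinite_primes_localOrder_holds`, bsd-jet).
WHY IT MIGHT FAIL: the printed proof separates eigen-classes using `−1 ∈ ρ̄(G_K)`; under bare irreducibility one needs
the Frobenii to span `End(E[p])`, which can fail for small exceptional images (normaliser-of-Cartan at `p = 3`).
[cite: McCallumLMS1991, §3 Cor. 3.2] [cite: Jetchev2008, Lemma 5.1, Rem. 6.2] -/
abbrev Sig.stub_cor32Irred : Prop :=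
  ∀ (N : ℕ) [NeZero N] (W : WeierstrassCurve ℚ) [W.IsElliptic] [W.IsGloballyMinimal],
        ¬ W.HasCM →
        ∀ (K : Type) [Field K] [NumberField K], IsImaginaryQuadratic K →
        ∀ (p : ℕ), p.Prime → p ≠ 2 → W.HasIrreducibleModPGaloisRep p →
        ∀ (c : K ≃ₐ[ℚ] K), c ≠ 1 →
        ∀ (M : ℕ), 1 ≤ M →
        ∀ (r : ℕ) (cs : Fin r → galH1Torsion (W.baseChange K) ((p ^ M : ℕ) : ℤ)),
          (∀ i, cs i ≠ 0) →
          (∀ i, ∃ e : ℤ, (e = 1 ∨ e = -1) ∧ conjAct W c ((p ^ M : ℕ) : ℤ) (cs i) = e • cs i) →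
          (∀ a : Fin r → ℤ, ∑ i, a i • cs i = 0 → ∀ i, (addOrderOf (cs i) : ℤ) ∣ a i) →
        ∀ (Mi : Fin r → ℕ), (∀ i, addOrderOf (cs i) = p ^ Mi i) →
        ∀ (Nv : Fin r → ℕ), (∀ i, Nv i ≤ Mi i) →
          Set.Infinite {ℓ : ℕ | FrobEqFrobInfty W K (p ^ M) ℓ ∧
            Zhang2014.IsKolyvaginPrime N W K p ℓ ∧ M ≤ Zhang2014.kolyvaginIndex W p ℓ ∧
            ∀ i, ∀ v : HeightOneSpectrum (𝓞 K), (ℓ : 𝓞 K) ∈ v.asIdeal →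
              ∀ j : ℕ, ((p ^ j : ℕ) : ℤ) • cs i ∈
                  (W.baseChange K).torsionLocalKer (v.adicCompletion K) ((p ^ M : ℕ) : ℤ) ↔
                Nv i ≤ j}

/-- Statement of `stub_prop44Irred` (NEW in v3; = the hypothesis `h44I` of p508713 VERBATIM): McCallum 1991 Prop. 4.4
— at a place `λ ∣ ℓ` of `K`, for compatible Kolyvagin–Heegner data of conductors `m` and `mℓ` (all prime factors
Kolyvagin of index `≥ M`), the `p^j`-multiples of the Kolyvagin class at `mℓ` lie in the Selmer local condition at `λ`
iff in the torsion local kernel, iff the same holds for the class at `m` — read with `E[p]` irreducible in place of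
surjectivity. WHY IT MIGHT FAIL: expected to be an image-free port of McCallum §4, but the additive place `p ∣ N` and
the ring-class-field ramification at `ℓ` have not been checked in this reading by anyone.
[cite: McCallumLMS1991, §4 Prop. 4.4] [cite: Jetchev2008, Prop. 4.4, Rem. 6.2] -/
abbrev Sig.stub_prop44Irred : Prop :=
  ∀ (W : WeierstrassCurve ℚ) [W.IsElliptic] [W.IsGloballyMinimal] [NeZero (W.conductorNorm ℤ)],
        ¬ W.HasCM →
        ∀ (K : Type) [Field K] [NumberField K], IsImaginaryQuadratic K →
        NumberField.discr K ≠ -3 → NumberField.discr K ≠ -4 →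
        SatisfiesHeegnerHypothesis (W.conductorNorm ℤ) K →
        ∀ (p : ℕ) [Fact p.Prime], p ≠ 2 → W.HasIrreducibleModPGaloisRep p →
        ∀ (Dt : ModularParametrizationData W (W.conductorNorm ℤ)) (β : ℤ) (ι : K →+* ℂ)
          (M : ℕ), 1 ≤ M →
        ∀ (m l : ℕ), Squarefree (m * l) → l.Prime → ¬ l ∣ m →
          (∀ l' ∈ (m * l).primeFactors, Zhang2014.IsKolyvaginPrime (W.conductorNorm ℤ) W K p l' ∧
            M ≤ Zhang2014.kolyvaginIndex W p l') →
        ∀ (d : KolyvaginHeegnerData Dt β ι m) (d' : KolyvaginHeegnerData Dt β ι (m * l)),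
          (∀ l' ∈ m.primeFactors, ∀ (x : ringClassField K ι m) (x' : ringClassField K ι (m * l)),
            (x : ℂ) = x' → ((d'.σ l' x' : ringClassField K ι (m * l)) : ℂ) = (d.σ l' x : ℂ)) →
          (∀ s ∈ d.S, ∃ s' ∈ d'.S, ∀ (x : ringClassField K ι m) (x' : ringClassField K ι (m * l)),
            (x : ℂ) = x' → ((s' x' : ringClassField K ι (m * l)) : ℂ) = (s x : ℂ)) →
          (∀ s' ∈ d'.S, ∃ s ∈ d.S, ∀ (x : ringClassField K ι m) (x' : ringClassField K ι (m * l)),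
            (x : ℂ) = x' → ((s' x' : ringClassField K ι (m * l)) : ℂ) = (s x : ℂ)) →
          (∀ (x : ringClassField K ι m) (x' : ringClassField K ι (m * l)),
            (x : ℂ) = x' → d'.emb x' = d.emb x) →
        ∀ (v : HeightOneSpectrum (𝓞 K)), (l : 𝓞 K) ∈ v.asIdeal →
        ∀ (j : ℕ),
          (((p ^ j : ℕ) : ℤ) • d'.kolyvaginClass (Fact.out : p.Prime) M ∈
              selmerLocalKer (W.baseChange K) (v.adicCompletion K) ((p ^ M : ℕ) : ℤ) ↔
            ((p ^ j : ℕ) : ℤ) • d'.kolyvaginClass (Fact.out : p.Prime) M ∈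
              (W.baseChange K).torsionLocalKer (v.adicCompletion K) ((p ^ M : ℕ) : ℤ)) ∧
          (((p ^ j : ℕ) : ℤ) • d'.kolyvaginClass (Fact.out : p.Prime) M ∈
              (W.baseChange K).torsionLocalKer (v.adicCompletion K) ((p ^ M : ℕ) : ℤ) ↔
            ((p ^ j : ℕ) : ℤ) • d.kolyvaginClass (Fact.out : p.Prime) M ∈
              (W.baseChange K).torsionLocalKer (v.adicCompletion K) ((p ^ M : ℕ) : ℤ))

/-- Statement of `stub_thm52KernelGapsAddv` (NEW in v3, **hardest**): for the ROW OBJECTS of `Sig.H63IRowObjectsAddv`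
(identical binders: non-CM `W`, Heegner field `K` with `d_K ∉ {−3,−4}`, `τ ≠ 1`, odd additive potentially good `p`
with `E[p]` irreducible, `p ∤ c_p`, the global Tamagawa binder, a non-torsion basic Heegner point, the carrier `q ∥ N`,
`q ≠ p`, the divisibility-index functions `mdiv`/`m` with minimum `m_∞` attained cofinally, a core vertex `c` at level
`k > max(ord_p c_q, m_∞)` with `k + m_∞ ≤ M(c)`), the INPUTS of p508713 beyond `h32I`/`h44I` hold: the named print
`hCM1` (Gross §3: `φ(x₁) ∈ E(K₁)`), `hCM2` (a generator of `Gal(K_c/K₁)` over `K`), Gross Prop. 5.3 for a Fricke sign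
`ε` (`h53`), [GZ86 III (3.1)] in the receptacle form with an `n′` prime to `p` (`hGZ`), AND THERE EXIST Selmer
structures `𝒯` (cutting out exactly the transverse classes at the primes of `c`), `𝒮 ≤` Kummer, carrier places `Qcar`
disjoint from `c`, `e′ = ε(−1)^(#primes of c)`, `C′ ≤` the `(−e′)`-sign part, with the five KERNEL GAPS of bsd-jet's
register row D5: `htr` (the classes at `c` are transverse at the primes of `c`), `hdual_q` (Thm. 5.1 at the carrier:
complementary ranges of the two localisation maps in a cyclic module of order `p^(ord_p c_q)`), `h49str` / `h49tr`
(Prop. 4.9: stringent part at `Qcar`, transverse part at the primes of `c`, for the classes at `cℓ`), `hdual_ℓ`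
(Thm. 5.1 / Lemma 5.2 (iii) at `λ ∣ ℓ`). WHY IT MIGHT FAIL: the stringent local condition at `v ∣ p` for an ADDITIVE
potentially supersingular `p` is the x11b3 layer theorem only under `p ∤ c_p` plus a uniformizer hypothesis unverified in
this regime, and `#dual = p^(ord_p c_q)` presumes the carrier's component group is the whole local defect at `q`
(true for `q ∥ N`, `q ≠ p` by Tate duality — to be matched against the tree's `localTamagawaNumber`); these are ALSO
bsd-jet's open tower-case gaps (register row D5). Sources: Jetchev 2008 §§4–5; bsd-jet `Rank1ResidualJetThm63KernelInputs.lean`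
(p501299) and register row D5; bsd-potss-k8t-c4 g8 FINDING v3 §6.
[cite: Jetchev2008, Prop. 4.9, Thm. 5.1, Lemma 5.2, Thm. 5.2 (p. 821)] [cite: GrossLMS1991, §3, Prop. 5.3]
[cite: GrossZagier1986, III (3.1)] -/
abbrev Sig.stub_thm52KernelGapsAddv : Prop :=
   ∀ (W : WeierstrassCurve ℚ) [W.IsElliptic] [W.IsGloballyMinimal] [NeZero (W.conductorNorm ℤ)],
    ¬ W.HasCM → ∀ (K : Type) [Field K] [NumberField K], IsImaginaryQuadratic K →
    NumberField.discr K ≠ -3 → NumberField.discr K ≠ -4 →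
    SatisfiesHeegnerHypothesis (W.conductorNorm ℤ) K →
    ∀ (τ : K ≃ₐ[ℚ] K), τ ≠ 1 →
    ∀ (p : ℕ) [Fact p.Prime], p ≠ 2 → Rank1Residual.Addv W p → 0 ≤ padicValRat p W.j →
    W.HasIrreducibleModPGaloisRep p →
    ¬ p ∣ (W.baseChange ℚ_[p]).localTamagawaNumber ℤ_[p] →
    (∀ (q' : ℕ) [Fact q'.Prime], q' ∣ W.conductorNorm ℤ →
      p ∣ (W.baseChange ℚ_[q']).localTamagawaNumber ℤ_[q'] → ¬ q' ^ 2 ∣ W.conductorNorm ℤ) →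
    ∀ (Dt : ModularParametrizationData W (W.conductorNorm ℤ)) (β : ℤ) (ι : K →+* ℂ)
      [∀ k : ℕ, NumberField (ringClassField K ι k)]
      (d₁ : KolyvaginHeegnerData Dt β ι 1), ¬ IsOfFinAddOrder d₁.derivedPoint →
    ∀ (q : ℕ) [Fact q.Prime], q ∣ W.conductorNorm ℤ → ¬ q ^ 2 ∣ W.conductorNorm ℤ → q ≠ p →
    ∀ (mdiv m : {c : ℕ // Squarefree c ∧ ∀ ℓ ∈ c.primeFactors,
        Zhang2014.IsKolyvaginPrime (W.conductorNorm ℤ) W K p ℓ} → ℕ∞),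
    (∀ c (u : ℕ), (u : ℕ∞) ≤ mdiv c ↔ ∀ d : KolyvaginHeegnerData Dt β ι c.1,
      ∃ Q : (W.baseChange (ringClassField K ι c.1)).toAffine.Point,
        ((p ^ u : ℕ) : ℤ) • Q = d.derivedPoint) →
    (∀ c, m c = if mdiv c < Zhang2014.levelIndex W p c.1 then mdiv c else ⊤) →
    ∀ mInf : ℕ, (∀ c, (mInf : ℕ∞) ≤ m c) →
      (∀ m' : ℕ, ∃ c, (m' : ℕ∞) ≤ Zhang2014.levelIndex W p c.1 ∧ m c = mInf) →
    ∀ (k : ℕ) c, 1 ≤ k → Jetchev2008.IsGlobalCoreVertex W K ι τ p k c.1 → m c = mInf →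
      (k : ℕ∞) + mInf ≤ Zhang2014.levelIndex W p c.1 →
      padicValNat p ((W.baseChange ℚ_[q]).localTamagawaNumber ℤ_[q]) < k → mInf < k →
      (phi_heegnerPointOfConductor_mem_range_map_ringClassField (W.conductorNorm ℤ) W K ∧
      exists_generator_ringClassGalOver K ∧
      ∃ (ε : ℤ), (ε = 1 ∨ ε = -1) ∧
        (∀ (m : ℕ) (dm : KolyvaginHeegnerData Dt β ι m)
          (τm : ringClassField K ι m ≃ₐ[ℚ] ringClassField K ι m),
          (∀ x : ringClassField K ι m, ((τm x : ringClassField K ι m) : ℂ) = starRingEnd ℂ x) →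
          ∃ σ' ∈ ringClassGal ι m, IsOfFinAddOrder
          (pointGalHom W (ringClassField K ι m) τm dm.y -
          ε • pointGalHom W (ringClassField K ι m) σ' dm.y)) ∧
        ∃ (n' : ℤ), IsCoprime (p : ℤ) n' ∧
        (∀ (m : ℕ) (dm : KolyvaginHeegnerData Dt β ι m)
          (γ : ringClassField K ι m ≃ₐ[ℚ] ringClassField K ι m), γ ∈ ringClassGal ι m →
          ∀ v : HeightOneSpectrum (𝓞 K), ¬ (W.baseChange K).HasGoodReductionAt v →
          n' • pointsMap (W.baseChange K) (v.adicCompletion K)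
          (dm.toGeomPoints (pointGalHom W (ringClassField K ι m) γ dm.y)) ∈
          E0Receptacle (W.baseChange K) v ∧
          ∀ (ℓ : ℕ), ℓ ∈ m.primeFactors → ∀ (dm' : KolyvaginHeegnerData Dt β ι (m / ℓ))
          (hle : ringClassField K ι (m / ℓ) ≤ ringClassField K ι m),
          n' • pointsMap (W.baseChange K) (v.adicCompletion K)
          (dm.toGeomPoints (pointGalHom W (ringClassField K ι m) γ
          (WeierstrassCurve.Affine.Point.map (W' := W)
          ((RingClassField.inclusion ι hle).restrictScalars ℚ) dm'.y))) ∈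
          E0Receptacle (W.baseChange K) v) ∧
        ∃ (𝒯 𝒮 : SelmerStructure ((W.baseChange K).torsionGaloisModule ((p ^ k : ℕ) : ℤ)))
          (Qcar : Finset (HeightOneSpectrum (𝓞 K))) (e' : ℤ)
          (C' : AddSubgroup (galH1Torsion (W.baseChange K) ((p ^ k : ℕ) : ℤ))),
          (∀ x : galoisCohomology ((W.baseChange K).torsionGaloisModule ((p ^ k : ℕ) : ℤ)) 1,
            (∀ w ∈ placesDividing K c.1,
            galoisCohomology.localization ((W.baseChange K).torsionGaloisModule ((p ^ k : ℕ) : ℤ))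
            (Sum.inr w) 1 x ∈ 𝒯 (Sum.inr w)) ↔
            ∀ ℓ ∈ c.1.primeFactors, x ∈ transverseKer W K ι ((p ^ k : ℕ) : ℤ) ℓ) ∧
          (∀ v, 𝒮 v ≤ (W.baseChange K).kummerSelmerStructure ((p ^ k : ℕ) : ℤ) v) ∧
          Disjoint Qcar (placesDividing K c.1) ∧
          e' = ε * (-1) ^ c.1.primeFactors.card ∧
          C' ≤ signPart W K τ ((p ^ k : ℕ) : ℤ) (-e') ⊤ ∧
          (∀ (d : KolyvaginHeegnerData Dt β ι c.1), ∀ ℓ ∈ c.1.primeFactors,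
            (d.kolyvaginClass (Fact.out : p.Prime) k :
            galoisCohomology ((W.baseChange K).torsionGaloisModule ((p ^ k : ℕ) : ℤ)) 1) ∈
            transverseKer W K ι ((p ^ k : ℕ) : ℤ) ℓ) ∧
          (∃ (Qg Qg' : Type) (_ : AddCommGroup Qg) (_ : AddCommGroup Qg') (_ : Finite Qg')
            (locq : signPart W K τ ((p ^ k : ℕ) : ℤ) (-e')
            (modifiedSelmerGroup W K ι ((p ^ k : ℕ) : ℤ) c.1) →+ Qg)
            (locq' : C' →+ Qg'),
            (∀ x : C', locq' x = 0 ↔ (x : galH1Torsion (W.baseChange K) ((p ^ k : ℕ) : ℤ)) ∈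
            signPart W K τ ((p ^ k : ℕ) : ℤ) (-e') (modifiedSelmerGroup W K ι ((p ^ k : ℕ) : ℤ) c.1)) ∧
            Nat.card locq.range * Nat.card locq'.range = Nat.card Qg' ∧ IsAddCyclic Qg' ∧ Nat.card Qg' = p ^ padicValNat p ((W.baseChange ℚ_[q]).localTamagawaNumber ℤ_[q])) ∧
          (∀ (ℓ : ℕ), Zhang2014.IsKolyvaginPrime (W.conductorNorm ℤ) W K p ℓ →
            k ≤ Zhang2014.kolyvaginIndex W p ℓ → ℓ ∉ c.1.primeFactors →
            ∀ (d' : KolyvaginHeegnerData Dt β ι (c.1 * ℓ)), ∀ q ∈ Qcar,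
            galoisCohomology.localization ((W.baseChange K).torsionGaloisModule ((p ^ k : ℕ) : ℤ))
            (Sum.inr q) 1 (d'.kolyvaginClass (Fact.out : p.Prime) k) ∈ 𝒮 (Sum.inr q)) ∧
          (∀ (ℓ : ℕ), Zhang2014.IsKolyvaginPrime (W.conductorNorm ℤ) W K p ℓ →
            k ≤ Zhang2014.kolyvaginIndex W p ℓ → ℓ ∉ c.1.primeFactors →
            ∀ (d' : KolyvaginHeegnerData Dt β ι (c.1 * ℓ)), ∀ w ∈ placesDividing K c.1,
            galoisCohomology.localization ((W.baseChange K).torsionGaloisModule ((p ^ k : ℕ) : ℤ))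
            (Sum.inr w) 1 (d'.kolyvaginClass (Fact.out : p.Prime) k) ∈ 𝒯 (Sum.inr w)) ∧
          (∀ (ℓ : ℕ), Zhang2014.IsKolyvaginPrime (W.conductorNorm ℤ) W K p ℓ →
            k ≤ Zhang2014.kolyvaginIndex W p ℓ → ℓ ∉ c.1.primeFactors →
            ∀ (v : HeightOneSpectrum (𝓞 K)), (ℓ : 𝓞 K) ∈ v.asIdeal →
            ∃ (Sg : Type) (_ : AddCommGroup Sg)
            (sing : signPart W K τ ((p ^ k : ℕ) : ℤ) (-e')
            (((selmerF0 W ((p ^ k : ℕ) : ℤ) 𝒯 𝒮 (placesDividing K c.1) Qcar).relaxedAt {v}).selmerGroup) →+ Sg),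
            (∀ x, sing x = 0 ↔ (x : galoisCohomology ((W.baseChange K).torsionGaloisModule ((p ^ k : ℕ) : ℤ)) 1) ∈
            signPart W K τ ((p ^ k : ℕ) : ℤ) (-e')
            ((selmerF0 W ((p ^ k : ℕ) : ℤ) 𝒯 𝒮 (placesDividing K c.1) Qcar).selmerGroup)) ∧
            Nat.card sing.range *
            Nat.card (C'.map (galoisCohomology.localization
            ((W.baseChange K).torsionGaloisModule ((p ^ k : ℕ) : ℤ)) (Sum.inr v) 1 :
            galH1Torsion (W.baseChange K) ((p ^ k : ℕ) : ℤ) →+ _)) = p ^ k))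

/-- Statement of `stub_publishedInputsHeegner` (cite): the route's HELD conjunction `PublishedInputsHeegner`
(item 19914) BY NAME — byte-identical to v1. -/
abbrev Sig.stub_publishedInputsHeegner : Prop := PublishedInputsHeegner

theorem stub_structureIrred : Sig.stub_structureIrred := by
  sorry

theorem stub_prop52Irred : Sig.stub_prop52Irred := by
  sorry

theorem stub_coreVertexExistenceIrred : Sig.stub_coreVertexExistenceIrred := by
  sorry

theorem stub_cor32Irred : Sig.stub_cor32Irred := by
  sorry

theorem stub_prop44Irred : Sig.stub_prop44Irred := by
  sorry

theorem stub_thm52KernelGapsAddv : Sig.stub_thm52KernelGapsAddv := by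
  sorry

theorem stub_publishedInputsHeegner : Sig.stub_publishedInputsHeegner := by
  sorry

/-- **v2's hardest stub is PROVED from the three new stubs** (k8t-c4 g8's kernel cut p508713): supply the row's
named print, sign, GZ integer, structures and gaps from `stub_thm52KernelGapsAddv`, `p ∣ N` from `Addv`,
`t := ord_p c_q`, and call `tamagawaExponent_le_mInfty_of_kernelInputs_of_irreducible`. A REAL proof.
[cite: Jetchev2008, Thm. 5.2 (p. 821) and proof] -/
theorem H63IRowObjectsAddv_of (h32 : Sig.stub_cor32Irred) (h44 : Sig.stub_prop44Irred)
    (hKG : Sig.stub_thm52KernelGapsAddv) : Sig.H63IRowObjectsAddv := by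
  intro W _ _ _ hcm K _ _ hK hD3 hD4 hH τ hτ p _ hp2 hadd hj hirr hcp htam Dt β ι _ d₁ hd₁ q _ hq hq2 hqp
    mdiv m hmdiv hm mInf hmin hwit k c hk hcore hmc hkM htk hik
  obtain ⟨hCM1, hCM2, ε, hε, h53, n', hcop', hGZ, 𝒯, 𝒮, Qcar, e', C', hT, hS, hQcar, he', hC, htr, hdual_q,
      h49str, h49tr, hdual_ℓ⟩ :=
    hKG W hcm K hK hD3 hD4 hH τ hτ p hp2 hadd hj hirr hcp htam Dt β ι d₁ hd₁ q hq hq2 hqp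
      mdiv m hmdiv hm mInf hmin hwit k c hk hcore hmc hkM htk hik
  exact JetchevIrreducibleReadingThm52.tamagawaExponent_le_mInfty_of_kernelInputs_of_irreducible h32 h44 W hcm
    K hK hD3 hD4 hH hCM1 hCM2 p hp2 hirr ((W.dvd_conductorNorm_iff_not_hasGoodReductionAtPrime p).mpr hadd.1)
    Dt β ι τ hτ ε hε h53 hcop' hGZ mdiv m hmdiv hm k c hk hcore mInf hmc hkM _ htk hik 𝒯 𝒮 hT hS Qcar hQcar
    e' he' C' hC htr hdual_q h49str h49tr hdual_ℓ

/-- **S2 of v1 is now PROVED from the three new stubs** (g8's kernel cut p504855, with `hRCF` discharged by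
`JET.numberField_ringClassField`): the body of v1's `Sig.stub_divisibilityIrredAddv`, renamed
`Sig.S2DivisibilityIrredAddv` (no longer a stub). [cite: Jetchev2008, Thm. 1.4 (ii), Prop. 5.3, Thm. 5.2] -/
theorem S2DivisibilityIrredAddv_of (h52 : Sig.stub_prop52Irred) (hCV : Sig.stub_coreVertexExistenceIrred)
    (h63 : Sig.H63IRowObjectsAddv) : Sig.S2DivisibilityIrredAddv :=
  divisibilityIrredAddv_of_prop52Irred_of_coreVertexExistenceIrred_of_thm63 h52 hCV
    (fun K _ _ ι hK k ↦ Summit.BirchSwinnertonDyer.Rank1Residual.JET.numberField_ringClassField K hK ι k) h63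

/-- **The crux from the seven stubs (K8-t′ decl)** — g8's capstone p502280 fed with S1, the proved S2 and PIH.
A REAL proof; sorries only inside the stubs. [cite: Jetchev2008, Cor. 1.5 (p. 812)] [cite: MatarNekovar2019, Thm. 0.7, §0.11] -/
theorem JetchevIrreducibleReadingByName_of (hS : Sig.stub_structureIrred) (h52 : Sig.stub_prop52Irred)
    (hCV : Sig.stub_coreVertexExistenceIrred) (h32 : Sig.stub_cor32Irred) (h44 : Sig.stub_prop44Irred)
    (hKG : Sig.stub_thm52KernelGapsAddv) (hH : Sig.stub_publishedInputsHeegner) :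
    Summit.BirchSwinnertonDyer.BirchSwinnertonDyer.Theses.KatoDescentTamePotSupersingular.JetchevIrreducibleReadingByName :=
  JetchevIrreducibleReadingOfStubs.jetchevIrreducibleReadingByName_of_structureIrred_of_divisibilityIrred_of_publishedInputsHeegner
    hS (S2DivisibilityIrredAddv_of h52 hCV (H63IRowObjectsAddv_of h32 h44 hKG)) hH

/-- **The K9 face (shared signature)** — g8's twin capstone p502729. -/
theorem JetchevIrreducibleReadingByName_of_K9 (hS : Sig.stub_structureIrred) (h52 : Sig.stub_prop52Irred)
    (hCV : Sig.stub_coreVertexExistenceIrred) (h32 : Sig.stub_cor32Irred) (h44 : Sig.stub_prop44Irred)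
    (hKG : Sig.stub_thm52KernelGapsAddv) (hH : Sig.stub_publishedInputsHeegner) :
    Summit.BirchSwinnertonDyer.BirchSwinnertonDyer.Theses.KatoDescentPotSupersingular.JetchevIrreducibleReadingByName :=
  WildJetchevIrreducibleReadingOfStubs.jetchevIrreducibleReadingByName_of_structureIrred_of_divisibilityIrred_of_publishedInputsHeegner
    hS (S2DivisibilityIrredAddv_of h52 hCV (H63IRowObjectsAddv_of h32 h44 hKG)) hH

/-- Sanity composition with the sorried stubs (what a sorry-free skeleton would deliver). -/
theorem jetchevIrreducibleReadingByName_of_stubs :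
    Summit.BirchSwinnertonDyer.BirchSwinnertonDyer.Theses.KatoDescentTamePotSupersingular.JetchevIrreducibleReadingByName :=
  JetchevIrreducibleReadingByName_of stub_structureIrred stub_prop52Irred stub_coreVertexExistenceIrred
    stub_cor32Irred stub_prop44Irred stub_thm52KernelGapsAddv stub_publishedInputsHeegner

end Summit.BirchSwinnertonDyer.BirchSwinnertonDyer.Cruxes.JetchevIrreducibleReadingByName.BirthV3

end
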